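import Summits.Langlands.Langlands.Theses.IrreducibilityBySelfDuality

/-!
# `PairLBoundaryJS` — negative lane: the exclusion `¬ X` and the Satake linkage are load-bearing

Refuter-side support for the crux `PairLBoundaryJS` (item stmt-Langlands-13622, route
`route-Langlands-IrreducibilityBySelfDuality`; Arthur–Clozel, Ann. of Math. Stud. 120, Ch. 3 §2 (2.2)
for cuspidal Borel–Jacquet data), cycle 1 of the standing disprover
(`Cruxes/PairLBoundaryJS/Disproof.lean` §(a)). No statement of the route is proved or refuted: the two
theorems refute WEAKENINGS of the crux's hypotheses (stated inline, verbatim the crux text with one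
clause removed), in the only inhabitable rank `(1, 1)` over `ℚ`.

* `pairLBoundaryJS_false_without_X` — the crux with the exclusion
  `¬ X` dropped is FALSE: for the trivial character of `GL_1(𝔸_ℚ)` paired with itself, `α = β = {1}`,
  `s₀ = 1 ∈ X`, the partial product is `ζ_ℚ^S(s)`, which has a simple pole at `1`
  (`tendsto_sub_one_mul_tprod_eulerFactor_one_numberField`) and hence no finite limit. So the typed
  `X` (`q_w^{1-s₀} α_w = β_w⁻¹` a.e.) does contain the pole, and any proof must use `¬ X`.
* `pairLBoundaryJS_false_without_satakeLink` — the crux with the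
  link `HasSatakeParamAt` to cuspidal data dropped (keeping cardinalities and the unitarity clauses) is
  FALSE: the unitary "Liouville family" `α_w = {-1}`, `β_w = {1}` is off `X` at `s₀ = 1` and gives
  `∏_{p ∉ S} (1 + p^{-s})⁻¹ = ζ^S(2s) / ζ^S(s) → 0` (`tprod_onePlus_mul_zeta`, the pole of `ζ_ℚ^S`, and
  the continuity of `ζ_ℚ` at `2` via `tprod_eulerFactor_one_eq_dedekindZetaCont_mul_prod`): a boundary
  ZERO, so the non-vanishing half of (2.2) (Shahidi) is automorphic input and not a property of unitary
  Euler products of Satake type.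
-/

noncomputable section

-- `Summit.Langlands.Langlands.…` (summit = sub-problem name, D-0017 layout) trips `dupNamespace` on
-- every declaration; the lakefile sets `weak.linter.dupNamespace = false` project-wide.
set_option linter.dupNamespace false

open scoped Topology
open NumberField IsDedekindDomain MeasureTheory Filter
open Literature.NumberTheory.Automorphic AdelicGroupData
open Literature.NumberTheory.GaloisRepresentations

namespace Summit.Langlands.Langlands.Theorems.PairLBoundaryJS.Negative

/-- The trivial character of `GL_1(𝔸_F)` as a cuspidal Borel–Jacquet datum with Satake parameter
`{1}` at all but finitely many places (tree: `exists_cuspidal_glOne_hasSatakeParamAt_valueAtUniformizer`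
with `θ = 1`). [cite: BorelJacquetCorvallis1979, 4.6] -/
theorem exists_trivial_glOne (F : Type) [Field F] [NumberField F]
    (h1 : isCompact_glFiniteIntegralLevel 1 F) :
    ∃ τ : CuspidalAutomorphicRepData 1 F h1,
      ∀ᶠ w : HeightOneSpectrum (𝓞 F) in cofinite, τ.1.HasSatakeParamAt w {1} := by
  obtain ⟨τ, hτ⟩ := exists_cuspidal_glOne_hasSatakeParamAt_valueAtUniformizer h1 (1 : HeckeCharacter F)
  refine ⟨τ, ?_⟩
  filter_upwards [hτ] with w hw
  have h1v : (1 : HeckeCharacter F).valueAtUniformizer w = 1 := by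
    rw [HeckeCharacter.valueAtUniformizer, HeckeCharacter.localComponent_apply,
      HeckeCharacter.one_apply, Units.val_one]
  rwa [h1v] at hw

/-- **`¬ X` is load-bearing (tightness of the exclusion).** Witness: `n = m = 1`, `F = ℚ`,
`π = π' = 1` (trivial character), `α = β = {1}`, `s₀ = 1 ∈ X`: the partial product is `ζ_ℚ^S(s)`,
and `(s - 1) ζ_ℚ^S(s) → c' ≠ 0` (`tendsto_sub_one_mul_tprod_eulerFactor_one_numberField`), so no
finite limit `c` exists (else `(s-1)·L → 0`). Any proof of the crux must use `¬ X`; and the typed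
`X` does contain this pole (`q_w^{1-1}·1 = 1⁻¹`). [cite: ArthurClozelAMS120, Ch. 3 §2 (2.2)–(2.3), p. 171] -/
theorem pairLBoundaryJS_false_without_X :
    ¬ (∀ (n m : ℕ) (F : Type) [Field F] [NumberField F] (hF : isCompact_glFiniteIntegralLevel n F)
        (hF' : isCompact_glFiniteIntegralLevel m F), 0 < n → 0 < m →
        ∀ (π : CuspidalAutomorphicRepData n F hF) (π' : CuspidalAutomorphicRepData m F hF'),
        ∃ S₀ : Set (HeightOneSpectrum (𝓞 F)), S₀.Finite ∧
          ∀ {S : Set (HeightOneSpectrum (𝓞 F))}, S.Finite → S₀ ⊆ S →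
          ∀ {α β : HeightOneSpectrum (𝓞 F) → Multiset ℂ},
            (∀ w ∉ S, π.1.HasSatakeParamAt w (α w)) → (∀ w ∉ S, π'.1.HasSatakeParamAt w (β w)) →
            (∀ w ∉ S, ‖(α w).prod‖ = 1) → (∀ w ∉ S, ‖(β w).prod‖ = 1) →
            ∀ {s₀ : ℂ}, s₀.re = 1 →
              ∃ c : ℂ, c ≠ 0 ∧ Tendsto (fun s : ℂ =>
                ∏' w : {w : HeightOneSpectrum (𝓞 F) // w ∉ S},
                  ((satakePairPolynomial (α w.1) (β w.1)).eval ((w.1.residueCard : ℂ) ^ (-s)))⁻¹)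
                (𝓝[{s : ℂ | 1 < s.re}] s₀) (𝓝 c)) := by
  intro h
  have h1 : isCompact_glFiniteIntegralLevel 1 ℚ := isCompact_glFiniteIntegralLevel_holds 1 ℚ
  obtain ⟨τ, hτ⟩ := exists_trivial_glOne ℚ h1
  obtain ⟨S₀, hS₀, hmain⟩ := h 1 1 ℚ h1 h1 one_pos one_pos τ τ
  have hE : {w : HeightOneSpectrum (𝓞 ℚ) | ¬ τ.1.HasSatakeParamAt w {1}}.Finite :=
    Filter.eventually_cofinite.1 hτ
  obtain ⟨S, hSdef⟩ : ∃ S : Set (HeightOneSpectrum (𝓞 ℚ)),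
      S = S₀ ∪ {w | ¬ τ.1.HasSatakeParamAt w {1}} := ⟨_, rfl⟩
  have hS : S.Finite := hSdef ▸ hS₀.union hE
  have hS₀S : S₀ ⊆ S := hSdef ▸ Set.subset_union_left
  have hα : ∀ w ∉ S, τ.1.HasSatakeParamAt w ((fun _ => ({1} : Multiset ℂ)) w) := by
    intro w hw
    by_contra hno
    exact hw (hSdef ▸ Or.inr hno)
  have hu : ∀ w ∉ S, ‖((fun _ => ({1} : Multiset ℂ)) w).prod‖ = 1 := by
    intro w _
    simp
  obtain ⟨c, -, hlim⟩ := hmain hS hS₀S hα hα hu hu Complex.one_re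
  have hfun : (fun s : ℂ => ∏' w : {w : HeightOneSpectrum (𝓞 ℚ) // w ∉ S},
      ((satakePairPolynomial ((fun _ => ({1} : Multiset ℂ)) w.1)
        ((fun _ => ({1} : Multiset ℂ)) w.1)).eval ((w.1.residueCard : ℂ) ^ (-s)))⁻¹) =
      fun s : ℂ => ∏' w : {w : HeightOneSpectrum (𝓞 ℚ) // w ∉ S},
        (1 - ((w.1.residueCard : ℂ) ^ (-s)))⁻¹ := by
    funext s
    refine tprod_congr fun w => ?_
    rw [eval_satakePairPolynomial_singleton, one_mul, one_mul]
  rw [hfun] at hlim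
  obtain ⟨c', hc', hpole⟩ := tendsto_sub_one_mul_tprod_eulerFactor_one_numberField (K := ℚ) hS
  have h0 := tendsto_sub_one_nhdsWithin_one_lt_re.mul hlim
  rw [zero_mul] at h0
  exact hc' (tendsto_nhds_unique hpole h0)

/-- `∏'_{w ∉ S} (1 + q_w^{-s})⁻¹ · ζ_ℚ^S(s) = ζ_ℚ^S(2s)` for `Re s > 1` (both products multipliable:
`multipliable_inv_eval_satakePairPolynomial_of_rpow`, `multipliable_inv_one_sub_residueCard_cpow_neg`). [folklore] -/
theorem tprod_onePlus_mul_zeta {F : Type} [Field F] [NumberField F]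
    (S : Set (HeightOneSpectrum (𝓞 F))) {s : ℂ} (hs : 1 < s.re) :
    (∏' w : {w : HeightOneSpectrum (𝓞 F) // w ∉ S}, (1 + ((w.1.residueCard : ℂ) ^ (-s)))⁻¹) *
      (∏' w : {w : HeightOneSpectrum (𝓞 F) // w ∉ S}, (1 - ((w.1.residueCard : ℂ) ^ (-s)))⁻¹) =
      ∏' w : {w : HeightOneSpectrum (𝓞 F) // w ∉ S},
        (1 - ((w.1.residueCard : ℂ) ^ (-(2 * s))))⁻¹ := by
  have hmulP : Multipliable fun w : {w : HeightOneSpectrum (𝓞 F) // w ∉ S} =>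
      (1 + ((w.1.residueCard : ℂ) ^ (-s)))⁻¹ := by
    have h := multipliable_inv_eval_satakePairPolynomial_of_rpow (S := S)
      (α := fun _ => ({-1} : Multiset ℂ)) (β := fun _ => ({1} : Multiset ℂ)) (N := 1) (M := 1)
      (B := 0) (B' := 0)
      (fun v _ a ha => by
        rw [Multiset.mem_singleton] at ha
        rw [ha, norm_neg, norm_one, Real.rpow_zero])
      (fun v _ b hb => by
        rw [Multiset.mem_singleton] at hb
        rw [hb, norm_one, Real.rpow_zero])
      (fun v _ => by simp) (fun v _ => by simp) (s := s) (by simpa using hs)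
    refine h.congr fun w => ?_
    rw [eval_satakePairPolynomial_singleton]
    ring_nf
  have hmulZ := multipliable_inv_one_sub_residueCard_cpow_neg (K := F) S hs
  rw [← hmulP.tprod_mul hmulZ]
  refine tprod_congr fun w => ?_
  have hq : (w.1.residueCard : ℂ) ≠ 0 :=
    Nat.cast_ne_zero.2 (ne_of_gt (lt_trans zero_lt_one w.1.one_lt_residueCard))
  have hsq : (w.1.residueCard : ℂ) ^ (-(2 * s)) =
      ((w.1.residueCard : ℂ) ^ (-s)) * ((w.1.residueCard : ℂ) ^ (-s)) := by
    rw [← Complex.cpow_add _ _ hq]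
    ring_nf
  rw [hsq, ← mul_inv]
  congr 1
  ring

/-- **The Satake linkage is load-bearing (a unitary family with a boundary ZERO).** Witness:
`n = m = 1`, `F = ℚ`, `α_w = {-1}`, `β_w = {1}`, `s₀ = 1` (off `X`, since `-1 ≠ 1` at every place):
`L(s) = ∏_{p ∉ S} (1 + p^{-s})⁻¹ = ζ^S(2s) / ζ^S(s) → ζ^S(2) · 0 / res = 0` as `s → 1⁺`
(`tprod_onePlus_mul_zeta`, the pole `tendsto_sub_one_mul_tprod_eulerFactor_one_numberField`, and
continuity of `ζ_ℚ` at `2` through `tprod_eulerFactor_one_eq_dedekindZetaCont_mul_prod`), so no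
non-zero limit exists. The non-vanishing half of the crux is automorphic input. [folklore] -/
theorem pairLBoundaryJS_false_without_satakeLink :
    ¬ (∀ (n m : ℕ) (F : Type) [Field F] [NumberField F], 0 < n → 0 < m →
        ∃ S₀ : Set (HeightOneSpectrum (𝓞 F)), S₀.Finite ∧
          ∀ {S : Set (HeightOneSpectrum (𝓞 F))}, S.Finite → S₀ ⊆ S →
          ∀ {α β : HeightOneSpectrum (𝓞 F) → Multiset ℂ},
            (∀ w ∉ S, Multiset.card (α w) = n) → (∀ w ∉ S, Multiset.card (β w) = m) →
            (∀ w ∉ S, ‖(α w).prod‖ = 1) → (∀ w ∉ S, ‖(β w).prod‖ = 1) →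
            ∀ {s₀ : ℂ}, s₀.re = 1 →
              ¬ (n = m ∧ ∀ᶠ w in cofinite,
                  (α w).map ((((w.residueCard : ℂ) ^ (1 - s₀))) * ·) = (β w).map (·⁻¹)) →
              ∃ c : ℂ, c ≠ 0 ∧ Tendsto (fun s : ℂ =>
                ∏' w : {w : HeightOneSpectrum (𝓞 F) // w ∉ S},
                  ((satakePairPolynomial (α w.1) (β w.1)).eval ((w.1.residueCard : ℂ) ^ (-s)))⁻¹)
                (𝓝[{s : ℂ | 1 < s.re}] s₀) (𝓝 c)) := by
  intro h
  haveI := infinite_heightOneSpectrum ℚ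
  obtain ⟨S, hS, hmain⟩ := h 1 1 ℚ one_pos one_pos
  have hX : ¬ ((1 : ℕ) = 1 ∧ ∀ᶠ w : HeightOneSpectrum (𝓞 ℚ) in cofinite,
      ((fun _ => ({-1} : Multiset ℂ)) w).map ((((w.residueCard : ℂ) ^ (1 - (1 : ℂ)))) * ·) =
        ((fun _ => ({1} : Multiset ℂ)) w).map (·⁻¹)) := by
    rintro ⟨-, hev⟩
    have hfalse : ∀ᶠ _w : HeightOneSpectrum (𝓞 ℚ) in cofinite, False := by
      filter_upwards [hev] with w hw
      simp only [sub_self, Complex.cpow_zero, one_mul, Multiset.map_singleton, inv_one,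
        Multiset.singleton_inj] at hw
      norm_num at hw
    obtain ⟨_, hF⟩ := hfalse.exists
    exact hF
  obtain ⟨c, hc, hlim⟩ := hmain hS subset_rfl (α := fun _ => ({-1} : Multiset ℂ))
    (β := fun _ => ({1} : Multiset ℂ)) (fun w _ => by simp) (fun w _ => by simp)
    (fun w _ => by simp) (fun w _ => by simp) Complex.one_re hX
  -- the function is `P(s) = ∏' (1 + q^{-s})⁻¹`
  set P : ℂ → ℂ := fun s => ∏' w : {w : HeightOneSpectrum (𝓞 ℚ) // w ∉ S},
    (1 + ((w.1.residueCard : ℂ) ^ (-s)))⁻¹ with hPdef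
  set Z : ℂ → ℂ := fun s => ∏' w : {w : HeightOneSpectrum (𝓞 ℚ) // w ∉ S},
    (1 - ((w.1.residueCard : ℂ) ^ (-s)))⁻¹ with hZdef
  have hfun : (fun s : ℂ => ∏' w : {w : HeightOneSpectrum (𝓞 ℚ) // w ∉ S},
      ((satakePairPolynomial ((fun _ => ({-1} : Multiset ℂ)) w.1)
        ((fun _ => ({1} : Multiset ℂ)) w.1)).eval ((w.1.residueCard : ℂ) ^ (-s)))⁻¹) = P := by
    funext s
    refine tprod_congr fun w => ?_
    rw [eval_satakePairPolynomial_singleton]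
    ring_nf
  rw [hfun] at hlim
  -- pole of `Z = ζ_ℚ^S` at `1`
  obtain ⟨c', hc', hpole⟩ := tendsto_sub_one_mul_tprod_eulerFactor_one_numberField (K := ℚ) hS
  -- continuity of `s ↦ Z (2s)` at `1`, through `ζ_ℚ`
  classical
  set E : ℂ → ℂ := fun s => ∏ v ∈ hS.toFinset, (1 - ((v.residueCard : ℂ) ^ (-s))) with hEdef
  have hcontH := Literature.NumberTheory.LFunctions.NumberField.exists_isDedekindZetaContinuation_holds ℚ
  have hζdiff := Literature.NumberTheory.LFunctions.differentiableOn_dedekindZetaCont_of_exists ℚ hcontH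
  have h2ne : (2 : ℂ) * 1 ≠ 1 := by norm_num
  have hG : ContinuousAt (fun s : ℂ =>
      Literature.NumberTheory.LFunctions.dedekindZetaCont ℚ (2 * s) * E (2 * s)) 1 := by
    have h2 : Continuous fun s : ℂ => 2 * s := continuous_const.mul continuous_id
    refine ContinuousAt.mul ?_ ?_
    · have hζ : ContinuousAt (Literature.NumberTheory.LFunctions.dedekindZetaCont ℚ) (2 * 1) :=
        (hζdiff.differentiableAt (isOpen_compl_singleton.mem_nhds h2ne)).continuousAt
      exact ContinuousAt.comp (g := Literature.NumberTheory.LFunctions.dedekindZetaCont ℚ) hζ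
        h2.continuousAt
    · have hE : Continuous E := by
        refine continuous_finsetProd _ fun v _ => continuous_one_sub_residueCard_cpow_neg v
      exact (hE.comp h2).continuousAt
  have hZ2 : Tendsto (fun s : ℂ => Z (2 * s)) (𝓝[{s : ℂ | 1 < s.re}] 1)
      (𝓝 (Literature.NumberTheory.LFunctions.dedekindZetaCont ℚ (2 * 1) * E (2 * 1))) := by
    refine (hG.tendsto.mono_left nhdsWithin_le_nhds).congr' ?_
    filter_upwards [self_mem_nhdsWithin] with s hs
    have hs2 : 1 < (2 * s).re := by
      simp only [Complex.mul_re, Complex.re_ofNat, Complex.im_ofNat, zero_mul, sub_zero]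
      have : 1 < s.re := hs
      linarith
    exact (tprod_eulerFactor_one_eq_dedekindZetaCont_mul_prod hS hs2).symm
  -- `P = Z(2s) · (s - 1) · ((s - 1) Z s)⁻¹` eventually, hence `P → 0`
  have hP0 : Tendsto P (𝓝[{s : ℂ | 1 < s.re}] 1) (𝓝 0) := by
    have hprod := (hZ2.mul tendsto_sub_one_nhdsWithin_one_lt_re).mul (hpole.inv₀ hc')
    rw [mul_zero, zero_mul] at hprod
    refine hprod.congr' ?_
    filter_upwards [self_mem_nhdsWithin, hpole.eventually_ne hc'] with s hs hne
    have hs1 : 1 < s.re := hs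
    have hZne : Z s ≠ 0 := by
      intro h0
      apply hne
      change (s - 1) * Z s = 0
      rw [h0, mul_zero]
    have hid : P s * Z s = Z (2 * s) := tprod_onePlus_mul_zeta S hs1
    have hs0 : s - 1 ≠ 0 := sub_ne_zero.2 fun h1 => by
      rw [h1, Complex.one_re] at hs1
      exact lt_irrefl _ hs1
    change Z (2 * s) * (s - 1) * ((s - 1) * Z s)⁻¹ = P s
    rw [← hid]
    field_simp
  exact hc (tendsto_nhds_unique hlim hP0)

end Summit.Langlands.Langlands.Theorems.PairLBoundaryJS.Negative

end
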